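import Summits.BirchSwinnertonDyer.BirchSwinnertonDyer.Theorems.KolyvaginDepthDoorDepthTableKuriharaDecisive794a1B
import Summits.BirchSwinnertonDyer.BirchSwinnertonDyer.Theorems.KolyvaginDepthDoorDepthTableKernelRankTwo794a1
import Summits.BirchSwinnertonDyer.BirchSwinnertonDyer.Theorems.KolyvaginDepthDoorDepthTableKuriharaExactSides
import HarnessLib

/-!
# Route `KolyvaginDepthDoor`, crux `KolyvaginDepthSupplyKN` (stmt-BirchSwinnertonDyer-22820) —
# DEPTH TABLE v21, ROW `794a1` @ `(7, d_K = −23)` READ EXACTLY: the `rank = 2` conjunct DISCHARGED by the kernel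
# 2-descent (`C794a1.mordellWeilRank_eq_two`, `…KernelRankTwo794a1`, this generation) — bit ⟺ «`Ш(E)[7] = 0` ∧ `#Sel₇(E^{(−23)}) ≤ 7`»
# ⟺ «a unit mod-7 Kurihara number of `T₀ = [1, 0, 1, -1334, -30036]` at a cyclic level of depth ≤ 1» ⟺ «a unit AT THE ONE PRIME `197`»

Helper file of the lead prover of line `levelone` (kdd-p1 g25; `--supports stmt-BirchSwinnertonDyer-22820
--as helper`); it closes nothing and BSD is NOT proved by it.

v20 (g23/g24) read this row only MODULO RANK (`C794a1.exactRowZhang_7_neg23` in `…Decisive794a1B`: bit ⟺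
`rank E = 2 ∧ Ш(E)[7] = 0 ∧ #Sel₇(E^{(−23)}) ≤ 7`; `twistKuriharaClaim_197_of_bit`: bit ⟹ unit at `197`;
`cruxBody_of_unit_197`: unit ⟹ the crux's clause — the converse landing on the CLAUSE, not on the bit, «for want of a
2-descent certificate» (794 = 2·397; 2-division field d_K = −1588, h = 2)). v21 lands `rank E(ℚ) = 2` in the kernel (reflective
class-group 2-descent record checked by `decide +kernel`), so the row now reads EXACTLY like the twelve kernel-rank rows:

* `exactRowZhang_7_neg23_rankFree` — bit ⟺ «`Ш(E)[7] = 0` ∧ `#Sel₇(E^{(−23)}) ≤ 7`» ((γ) + W. Zhang L8.4 (1)/9.1 by name).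
* `kolyvaginPrime_iff_twistKuriharaBit_7_neg23` — bit ⟺ «every admissible datum of `T₀` has a unit mod-`7` Kurihara number at
  SOME cyclic Kolyvagin level of depth `≤ 1`» (E-side `Ш(E)[7] = 0` from the record claim `hδE` = `cert_794a1` @ `(7, 197·281)`
  via `C794a1.sha_inf_torsionBy_eq_bot_of_kuriharaClaim_7`; twist side `natCard_selmerGroup_quadraticTwist_le_iff_kuriharaBit`).
* `twistKuriharaBit_iff_unit_197` — **bit ⟺ unit `δ̃_197(T₀)`**: (⟹) v20's `twistKuriharaClaim_197_of_bit` (kernel: `73 • P̄ ≠ O` in `T̃₀(𝔽₅₄₇)`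
  for the tree's twist point `P = (102, 896)`, #T̃₀(𝔽₁₉₇) = 210 = 7·30, Sakamoto L4.4 + L4.6 (1) `hSak3`); (⟸) the socket iff with `m = 197`.
  So the fleet's ONE residue `δ̃_197(T₀) mod 7` (DECISIVE-RESIDUES-v20: a unit) decides the row BOTH WAYS modulo print —
  a ZERO would now refute the BIT at `(7, ℚ(√−23))`, not merely fail to prove the clause.
* `twistKuriharaBit_iff_unit_547`, `unit_197_iff_unit_547` — the second prime and the AGREEMENT test.

CONDITIONAL on the named facts displayed (`h372`, `h84`, `hKim`, `hSak1`, `hSak2`, `hSak3`, `hnf`, `hMaz`) and the E-side record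
claim `hδE`; per curve; nothing class-wide; BSD is NOT proved by any of this.

References: [Sakamoto2022pSelmer] Lemma 4.4, Lemma 4.6 (1), Thm. 1.2, Thm. 1.5; [Kim2022StructureSelmer] Thm. 1.11;
[WZhang2014] Lemma 8.4 (1), Thm. 9.1; [GrossLMS1991] Prop. 3.7 (2); [Mazur1978] Cor. 4.1; [Cassels1991LecturesEllipticCurves] §15;
[CremonaAlgorithms1997] Table 1 (794a1).
-/

set_option linter.dupNamespace false

noncomputable section

open scoped Classical NumberField

namespace Summit.BirchSwinnertonDyer.BirchSwinnertonDyer.Theorems.KolyvaginDepthDoor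

open Literature.NumberTheory.EllipticCurves Literature.NumberTheory.EllipticCurves.ModularForms
  WeierstrassCurve NumberField IsDedekindDomain
open Summit.BirchSwinnertonDyer.BirchSwinnertonDyer.Theorems
open Summit.BirchSwinnertonDyer.BirchSwinnertonDyer.Rank2Observatory

namespace C794a1

/-- **ROW `794a1` @ `(7, −23)`, EXACT (rank-free):** for every imaginary quadratic `K` with `d_K = −23`, granted (γ) (`h372`)
and W. Zhang L8.4 (1)/9.1 (`h84`) BY NAME, «some frame, some Kolyvagin PRIME `ℓ`, some datum of conductor `ℓ` with `c_1(ℓ) ≠ 0`»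
⟺ «`Ш(E/ℚ)[7] = 0` ∧ `#Sel₇(E^{(−23)}/ℚ) ≤ 7`» — v20's `exactRowZhang_7_neg23` with its `rank E(ℚ) = 2` conjunct DISCHARGED by the
kernel theorem `C794a1.mordellWeilRank_eq_two` (v21). Per curve; BSD is not proved by it.
[cite: WZhang2014, Lemma 8.4 (1) (p. 236), Thm. 9.1 (p. 240)] [cite: GrossLMS1991, Prop. 3.7 (2)] [cite: CremonaAlgorithms1997, Table 1 (794a1)] -/
theorem exactRowZhang_7_neg23_rankFree
    (h372 : GrossLMS1991.prop37_2_frobeniusCongruence)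
    (h84 : Literature.NumberTheory.EllipticCurves.WZhang2014_lemma84_exists_minimal_kolyvaginClass_one_selmerCard)
    (K : Type) [Field K] [NumberField K] (hK : IsImaginaryQuadratic K) (hD : NumberField.discr K = -23) :
    haveI := isElliptic_c794a1; haveI := isGloballyMinimal_c794a1;
      haveI : NeZero (((⟨1, 0, 1, -3, 2⟩ : WeierstrassCurve ℤ).map (Int.castRingHom ℚ)).conductorNorm ℤ) := neZero_conductorNorm_of_isElliptic _;
      haveI := Fact.mk (by norm_num : Nat.Prime 7);
    (∃ (Dt : ModularParametrizationData ((⟨1, 0, 1, -3, 2⟩ : WeierstrassCurve ℤ).map (Int.castRingHom ℚ)) (((⟨1, 0, 1, -3, 2⟩ : WeierstrassCurve ℤ).map (Int.castRingHom ℚ)).conductorNorm ℤ)) (β : ℤ)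
      (ι : K →+* ℂ) (ℓ : ℕ) (d : KolyvaginHeegnerData Dt β ι ℓ),
      ℓ.Prime ∧ Zhang2014.IsKolyvaginPrime (((⟨1, 0, 1, -3, 2⟩ : WeierstrassCurve ℤ).map (Int.castRingHom ℚ)).conductorNorm ℤ) ((⟨1, 0, 1, -3, 2⟩ : WeierstrassCurve ℤ).map (Int.castRingHom ℚ)) K 7 ℓ ∧
        d.kolyvaginClass (p := 7) (by norm_num) 1 ≠ 0) ↔
    ((((⟨1, 0, 1, -3, 2⟩ : WeierstrassCurve ℤ).map (Int.castRingHom ℚ)).sha ⊓ AddSubgroup.torsionBy ((⟨1, 0, 1, -3, 2⟩ : WeierstrassCurve ℤ).map (Int.castRingHom ℚ)).galH1 ((7 : ℕ) : ℤ) : AddSubgroup _) = ⊥ ∧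
      Nat.card ((((⟨1, 0, 1, -3, 2⟩ : WeierstrassCurve ℤ).map (Int.castRingHom ℚ)).quadraticTwist (NumberField.discr K : ℚ)).selmerGroup (7 : ℕ)) ≤ 7) := by
  haveI := isElliptic_c794a1
  haveI := isGloballyMinimal_c794a1
  haveI iNZ : NeZero (((⟨1, 0, 1, -3, 2⟩ : WeierstrassCurve ℤ).map (Int.castRingHom ℚ)).conductorNorm ℤ) :=
    neZero_conductorNorm_of_isElliptic _
  haveI iP := Fact.mk (by norm_num : Nat.Prime 7)
  rw [exactRowZhang_7_neg23 h372 h84 K hK hD, and_iff_right C794a1.mordellWeilRank_eq_two]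

/-- **ROW `794a1` @ `(7, −23)`: THE SOCKET IFF** — for every imaginary quadratic `K` with `d_K = −23`, granted (γ), W. Zhang
L8.4 (1)/9.1, Kim Thm. 1.11, Sakamoto Thm. 1.5 / Thm. 1.2, modularity, Mazur Cor. 4.1 BY NAME and the E-side record claim `hδE`
(`cert_794a1` @ `(7, 197·281)`): the depth-table bit ⟺ «every datum `D` of `T₀ = [1, 0, 1, -1334, -30036]` at level `N_{T₀}` with `7 ∤ c_D`
and the period transfer has a UNIT mod-`7` Kurihara number at SOME cyclic Kolyvagin level `m` of depth `≤ 1`». E-side: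
`Ш(E)[7] = 0` from `hδE` (`sha_inf_torsionBy_eq_bot_of_kuriharaClaim_7`); twist side: the exact generic
`natCard_selmerGroup_quadraticTwist_le_iff_kuriharaBit` at `r = 1`; rank: kernel. CONDITIONAL; per curve; BSD is not proved by it.
[cite: Sakamoto2022pSelmer, Thm. 1.2, Thm. 1.5] [cite: Kim2022StructureSelmer, Thm. 1.11] [cite: WZhang2014, Lemma 8.4 (1) (p. 236)]
[cite: GrossLMS1991, Prop. 3.7 (2)] [cite: Mazur1978, Cor. 4.1] [cite: CremonaAlgorithms1997, Table 1 (794a1)] -/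
theorem kolyvaginPrime_iff_twistKuriharaBit_7_neg23
    (h372 : GrossLMS1991.prop37_2_frobeniusCongruence)
    (h84 : Literature.NumberTheory.EllipticCurves.WZhang2014_lemma84_exists_minimal_kolyvaginClass_one_selmerCard)
    (hKim : Kim2022_card_selmerGroup_le_pow_of_kuriharaNumber_ne_zero)
    (hSak1 : Sakamoto2022_card_selmerGroup_eq_pow_of_isDeltaMinimal)
    (hSak2 : Sakamoto2022_exists_cyclicLevel_kuriharaNumber_ne_zero)
    (hnf : exists_isNewformOf) (hMaz : mazur_not_dvd_maninConstant_of_odd)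
    (K : Type) [Field K] [NumberField K] (hK : IsImaginaryQuadratic K) (hD : NumberField.discr K = -23)
    (hδE : haveI := isElliptic_c794a1; haveI := isGloballyMinimal_c794a1;
      haveI : NeZero (((⟨1, 0, 1, -3, 2⟩ : WeierstrassCurve ℤ).map (Int.castRingHom ℚ)).conductorNorm ℤ) := neZero_conductorNorm_of_isElliptic _;
      haveI := Fact.mk (by norm_num : Nat.Prime 7);
      ∀ (D : ModularParametrizationData ((⟨1, 0, 1, -3, 2⟩ : WeierstrassCurve ℤ).map (Int.castRingHom ℚ)) (((⟨1, 0, 1, -3, 2⟩ : WeierstrassCurve ℤ).map (Int.castRingHom ℚ)).conductorNorm ℤ)), ¬ ((7 : ℕ) : ℤ) ∣ D.maninConstant →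
        (∃ u : ℚ, ‖(u : ℚ_[7])‖ = 1 ∧ ((⟨1, 0, 1, -3, 2⟩ : WeierstrassCurve ℤ).map (Int.castRingHom ℚ)).realPeriodRat = u * plusPeriod D.f) →
        ∃ ψ : (ℓ : ℕ) → (ZMod ℓ)ˣ →* Multiplicative (ZMod 7),
          (∀ ℓ ∈ (55357 : ℕ).primeFactors, Function.Surjective (ψ ℓ)) ∧ kuriharaNumber D.f 7 55357 ψ ≠ 0) :
    haveI := isElliptic_c794a1; haveI := isGloballyMinimal_c794a1;
      haveI : NeZero (((⟨1, 0, 1, -3, 2⟩ : WeierstrassCurve ℤ).map (Int.castRingHom ℚ)).conductorNorm ℤ) := neZero_conductorNorm_of_isElliptic _;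
      haveI := Fact.mk (by norm_num : Nat.Prime 7);
    haveI := minTwist23_isElliptic; haveI := minTwist23_isGloballyMinimal;
    haveI : NeZero (((⟨1, 0, 1, -1334, -30036⟩ : WeierstrassCurve ℤ).map (Int.castRingHom ℚ)).conductorNorm ℤ) := neZero_conductorNorm_of_isElliptic _;
    (∃ (Dt : ModularParametrizationData ((⟨1, 0, 1, -3, 2⟩ : WeierstrassCurve ℤ).map (Int.castRingHom ℚ)) (((⟨1, 0, 1, -3, 2⟩ : WeierstrassCurve ℤ).map (Int.castRingHom ℚ)).conductorNorm ℤ)) (β : ℤ)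
      (ι : K →+* ℂ) (ℓ : ℕ) (d : KolyvaginHeegnerData Dt β ι ℓ),
      ℓ.Prime ∧ Zhang2014.IsKolyvaginPrime (((⟨1, 0, 1, -3, 2⟩ : WeierstrassCurve ℤ).map (Int.castRingHom ℚ)).conductorNorm ℤ) ((⟨1, 0, 1, -3, 2⟩ : WeierstrassCurve ℤ).map (Int.castRingHom ℚ)) K 7 ℓ ∧
        d.kolyvaginClass (p := 7) (by norm_num) 1 ≠ 0) ↔
    (∀ (D : ModularParametrizationData ((⟨1, 0, 1, -1334, -30036⟩ : WeierstrassCurve ℤ).map (Int.castRingHom ℚ))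
          (((⟨1, 0, 1, -1334, -30036⟩ : WeierstrassCurve ℤ).map (Int.castRingHom ℚ)).conductorNorm ℤ)),
        ¬ ((7 : ℕ) : ℤ) ∣ D.maninConstant →
        (∃ u : ℚ, ‖(u : ℚ_[7])‖ = 1 ∧
          ((⟨1, 0, 1, -1334, -30036⟩ : WeierstrassCurve ℤ).map (Int.castRingHom ℚ)).realPeriodRat = u * plusPeriod D.f) →
        ∃ (m : ℕ) (_ : NeZero m), IsCyclicKolyvaginLevel ((⟨1, 0, 1, -1334, -30036⟩ : WeierstrassCurve ℤ).map (Int.castRingHom ℚ)) 7 m ∧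
          m.primeFactors.card ≤ 1 ∧
          ∃ ψ : (ℓ : ℕ) → (ZMod ℓ)ˣ →* Multiplicative (ZMod 7),
            (∀ ℓ ∈ m.primeFactors, Function.Surjective (ψ ℓ)) ∧ kuriharaNumber D.f 7 m ψ ≠ 0) := by
  haveI := isElliptic_c794a1
  haveI := isGloballyMinimal_c794a1
  haveI iNZ : NeZero (((⟨1, 0, 1, -3, 2⟩ : WeierstrassCurve ℤ).map (Int.castRingHom ℚ)).conductorNorm ℤ) :=
    neZero_conductorNorm_of_isElliptic _
  haveI := minTwist23_isElliptic
  haveI := minTwist23_isGloballyMinimal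
  haveI iNZT : NeZero (((⟨1, 0, 1, -1334, -30036⟩ : WeierstrassCurve ℤ).map (Int.castRingHom ℚ)).conductorNorm ℤ) :=
    neZero_conductorNorm_of_isElliptic _
  haveI iP := Fact.mk (by norm_num : Nat.Prime 7)
  have hsha := sha_inf_torsionBy_eq_bot_of_kuriharaClaim_7 hKim hnf hMaz hδE
  have hsur : ((⟨1, 0, 1, -3, 2⟩ : WeierstrassCurve ℤ).map (Int.castRingHom ℚ)).HasSurjectiveModNGaloisRep ((7 : ℕ) : ℤ) := by
    simpa using hasSurjectiveModNGaloisRep_7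
  have hC : (⟨1, (-2 : ℚ), -((1 : ℚ) / 2), (1 : ℚ) / 2⟩ : WeierstrassCurve.VariableChange ℚ) •
      ((⟨1, 0, 1, -1334, -30036⟩ : WeierstrassCurve ℤ).map (Int.castRingHom ℚ)) =
      ((⟨1, 0, 1, -3, 2⟩ : WeierstrassCurve ℤ).map (Int.castRingHom ℚ)).quadraticTwist ((NumberField.discr K : ℤ) : ℚ) := by
    rw [hD]; push_cast; exact minTwist23_smul_eq
  have hpD : ¬ (((7 : ℕ) : ℤ) ∣ NumberField.discr K) := by rw [hD]; decide
  have hT := natCard_selmerGroup_quadraticTwist_le_iff_kuriharaBit hKim hSak1 hSak2 hnf hMaz _ 7 (by norm_num) goodOrdinary_7.1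
    goodOrdinary_7.2 hsur (NumberField.discr_ne_zero K) hpD _ _ hC minTwist23_nonAnomalous_7 (minTwist23_kodairaNeron_of_five_le 7 (by norm_num)) 1
  rw [pow_one] at hT
  rw [exactRowZhang_7_neg23_rankFree h372 h84 K hK hD, and_iff_right hsha]
  exact hT

/-- **ROW `794a1` @ `(7, −23)`: THE DECISIVE PRIME `197` — bit ⟺ unit `δ̃_197(T₀)`.** For every imaginary quadratic `K` with
`d_K = −23`, granted the eight named facts and the E-side claim `hδE`: the depth-table bit holds IF AND ONLY IF every admissible
datum of `T₀ = [1, 0, 1, -1334, -30036]` has a UNIT mod-`7` Kurihara number AT `197` — the claim of a future tree record `cert_<T₀>` @ `(7, 197)`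
(DECISIVE-RESIDUES-v20: computed, a unit). (⟹): v20's `twistKuriharaClaim_197_of_bit` (kernel certificate: `73 • P̄ ≠ O` in `T̃₀(𝔽₅₄₇)`,
#T̃₀(𝔽₁₉₇) = 210 = 7·30; `hSak3`); (⟸): `kolyvaginPrime_iff_twistKuriharaBit_7_neg23` with `m = 197` (`minTwist23_isCyclicKolyvaginLevel_7_197`).
A computed ZERO at `197` would REFUTE the bit at `(7, ℚ(√−23))` modulo print. CONDITIONAL; per curve; BSD is not proved by it.
[cite: Sakamoto2022pSelmer, Lemma 4.4, Lemma 4.6 (1), Thm. 1.2, Thm. 1.5] [cite: Kim2022StructureSelmer, Thm. 1.11]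
[cite: WZhang2014, Lemma 8.4 (1) (p. 236)] [cite: GrossLMS1991, Prop. 3.7 (2)] [cite: CremonaAlgorithms1997, Table 1 (794a1)] -/
theorem twistKuriharaBit_iff_unit_197
    (h372 : GrossLMS1991.prop37_2_frobeniusCongruence)
    (h84 : Literature.NumberTheory.EllipticCurves.WZhang2014_lemma84_exists_minimal_kolyvaginClass_one_selmerCard)
    (hKim : Kim2022_card_selmerGroup_le_pow_of_kuriharaNumber_ne_zero)
    (hSak1 : Sakamoto2022_card_selmerGroup_eq_pow_of_isDeltaMinimal)
    (hSak2 : Sakamoto2022_exists_cyclicLevel_kuriharaNumber_ne_zero)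
    (hSak3 : Literature.NumberTheory.EllipticCurves.Sakamoto2022_kuriharaNumber_prime_ne_zero_of_localNondivisible)
    (hnf : exists_isNewformOf) (hMaz : mazur_not_dvd_maninConstant_of_odd)
    (K : Type) [Field K] [NumberField K] (hK : IsImaginaryQuadratic K) (hD : NumberField.discr K = -23)
    (hδE : haveI := isElliptic_c794a1; haveI := isGloballyMinimal_c794a1;
      haveI : NeZero (((⟨1, 0, 1, -3, 2⟩ : WeierstrassCurve ℤ).map (Int.castRingHom ℚ)).conductorNorm ℤ) := neZero_conductorNorm_of_isElliptic _;
      haveI := Fact.mk (by norm_num : Nat.Prime 7);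
      ∀ (D : ModularParametrizationData ((⟨1, 0, 1, -3, 2⟩ : WeierstrassCurve ℤ).map (Int.castRingHom ℚ)) (((⟨1, 0, 1, -3, 2⟩ : WeierstrassCurve ℤ).map (Int.castRingHom ℚ)).conductorNorm ℤ)), ¬ ((7 : ℕ) : ℤ) ∣ D.maninConstant →
        (∃ u : ℚ, ‖(u : ℚ_[7])‖ = 1 ∧ ((⟨1, 0, 1, -3, 2⟩ : WeierstrassCurve ℤ).map (Int.castRingHom ℚ)).realPeriodRat = u * plusPeriod D.f) →
        ∃ ψ : (ℓ : ℕ) → (ZMod ℓ)ˣ →* Multiplicative (ZMod 7),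
          (∀ ℓ ∈ (55357 : ℕ).primeFactors, Function.Surjective (ψ ℓ)) ∧ kuriharaNumber D.f 7 55357 ψ ≠ 0) :
    haveI := isElliptic_c794a1; haveI := isGloballyMinimal_c794a1;
      haveI : NeZero (((⟨1, 0, 1, -3, 2⟩ : WeierstrassCurve ℤ).map (Int.castRingHom ℚ)).conductorNorm ℤ) := neZero_conductorNorm_of_isElliptic _;
      haveI := Fact.mk (by norm_num : Nat.Prime 7);
    haveI := minTwist23_isElliptic; haveI := minTwist23_isGloballyMinimal;
    haveI : NeZero (((⟨1, 0, 1, -1334, -30036⟩ : WeierstrassCurve ℤ).map (Int.castRingHom ℚ)).conductorNorm ℤ) := neZero_conductorNorm_of_isElliptic _;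
    (∃ (Dt : ModularParametrizationData ((⟨1, 0, 1, -3, 2⟩ : WeierstrassCurve ℤ).map (Int.castRingHom ℚ)) (((⟨1, 0, 1, -3, 2⟩ : WeierstrassCurve ℤ).map (Int.castRingHom ℚ)).conductorNorm ℤ)) (β : ℤ)
      (ι : K →+* ℂ) (ℓ : ℕ) (d : KolyvaginHeegnerData Dt β ι ℓ),
      ℓ.Prime ∧ Zhang2014.IsKolyvaginPrime (((⟨1, 0, 1, -3, 2⟩ : WeierstrassCurve ℤ).map (Int.castRingHom ℚ)).conductorNorm ℤ) ((⟨1, 0, 1, -3, 2⟩ : WeierstrassCurve ℤ).map (Int.castRingHom ℚ)) K 7 ℓ ∧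
        d.kolyvaginClass (p := 7) (by norm_num) 1 ≠ 0) ↔
    (∀ (D : ModularParametrizationData ((⟨1, 0, 1, -1334, -30036⟩ : WeierstrassCurve ℤ).map (Int.castRingHom ℚ))
          (((⟨1, 0, 1, -1334, -30036⟩ : WeierstrassCurve ℤ).map (Int.castRingHom ℚ)).conductorNorm ℤ)),
        ¬ ((7 : ℕ) : ℤ) ∣ D.maninConstant →
        (∃ u : ℚ, ‖(u : ℚ_[7])‖ = 1 ∧
          ((⟨1, 0, 1, -1334, -30036⟩ : WeierstrassCurve ℤ).map (Int.castRingHom ℚ)).realPeriodRat = u * plusPeriod D.f) →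
        ∃ ψ : (q : ℕ) → (ZMod q)ˣ →* Multiplicative (ZMod 7),
          (∀ q ∈ (197 : ℕ).primeFactors, Function.Surjective (ψ q)) ∧ kuriharaNumber D.f 7 197 ψ ≠ 0) := by
  haveI := isElliptic_c794a1
  haveI := isGloballyMinimal_c794a1
  haveI iNZ : NeZero (((⟨1, 0, 1, -3, 2⟩ : WeierstrassCurve ℤ).map (Int.castRingHom ℚ)).conductorNorm ℤ) :=
    neZero_conductorNorm_of_isElliptic _
  haveI := minTwist23_isElliptic
  haveI := minTwist23_isGloballyMinimal
  haveI iNZT : NeZero (((⟨1, 0, 1, -1334, -30036⟩ : WeierstrassCurve ℤ).map (Int.castRingHom ℚ)).conductorNorm ℤ) :=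
    neZero_conductorNorm_of_isElliptic _
  haveI iP := Fact.mk (by norm_num : Nat.Prime 7)
  haveI : Fact (Nat.Prime 197) := ⟨by norm_num⟩
  haveI : NeZero (197 : ℕ) := ⟨by norm_num⟩
  constructor
  · intro hbit
    exact twistKuriharaClaim_197_of_bit h372 h84 hSak3 K hK hD hbit
  · intro hunit
    refine (kolyvaginPrime_iff_twistKuriharaBit_7_neg23 h372 h84 hKim hSak1 hSak2 hnf hMaz K hK hD hδE).mpr fun D hc hu ↦ ?_
    obtain ⟨ψ, hψ, hne⟩ := hunit D hc hu
    refine ⟨197, inferInstance, minTwist23_isCyclicKolyvaginLevel_7_197, ?_, ψ, hψ, hne⟩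
    rw [Nat.Prime.primeFactors (by norm_num), Finset.card_singleton]

/-- **ROW `794a1` @ `(7, −23)`: the SECOND prime `547` — bit ⟺ unit `δ̃_547(T₀)`** (same reading at the second cyclic Kolyvagin
prime of the tree, kernel certificate `minTwist23_localNondivisible_547`, #T̃₀(𝔽₅₄₇) = 511 = 7·73). CONDITIONAL on the named facts and the
E-side claim; per curve; BSD is not proved by it. [cite: Sakamoto2022pSelmer, Lemma 4.4, Lemma 4.6 (1), Thm. 1.2, Thm. 1.5]
[cite: Kim2022StructureSelmer, Thm. 1.11] [cite: WZhang2014, Lemma 8.4 (1) (p. 236)] [cite: CremonaAlgorithms1997, Table 1 (794a1)] -/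
theorem twistKuriharaBit_iff_unit_547
    (h372 : GrossLMS1991.prop37_2_frobeniusCongruence)
    (h84 : Literature.NumberTheory.EllipticCurves.WZhang2014_lemma84_exists_minimal_kolyvaginClass_one_selmerCard)
    (hKim : Kim2022_card_selmerGroup_le_pow_of_kuriharaNumber_ne_zero)
    (hSak1 : Sakamoto2022_card_selmerGroup_eq_pow_of_isDeltaMinimal)
    (hSak2 : Sakamoto2022_exists_cyclicLevel_kuriharaNumber_ne_zero)
    (hSak3 : Literature.NumberTheory.EllipticCurves.Sakamoto2022_kuriharaNumber_prime_ne_zero_of_localNondivisible)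
    (hnf : exists_isNewformOf) (hMaz : mazur_not_dvd_maninConstant_of_odd)
    (K : Type) [Field K] [NumberField K] (hK : IsImaginaryQuadratic K) (hD : NumberField.discr K = -23)
    (hδE : haveI := isElliptic_c794a1; haveI := isGloballyMinimal_c794a1;
      haveI : NeZero (((⟨1, 0, 1, -3, 2⟩ : WeierstrassCurve ℤ).map (Int.castRingHom ℚ)).conductorNorm ℤ) := neZero_conductorNorm_of_isElliptic _;
      haveI := Fact.mk (by norm_num : Nat.Prime 7);
      ∀ (D : ModularParametrizationData ((⟨1, 0, 1, -3, 2⟩ : WeierstrassCurve ℤ).map (Int.castRingHom ℚ)) (((⟨1, 0, 1, -3, 2⟩ : WeierstrassCurve ℤ).map (Int.castRingHom ℚ)).conductorNorm ℤ)), ¬ ((7 : ℕ) : ℤ) ∣ D.maninConstant →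
        (∃ u : ℚ, ‖(u : ℚ_[7])‖ = 1 ∧ ((⟨1, 0, 1, -3, 2⟩ : WeierstrassCurve ℤ).map (Int.castRingHom ℚ)).realPeriodRat = u * plusPeriod D.f) →
        ∃ ψ : (ℓ : ℕ) → (ZMod ℓ)ˣ →* Multiplicative (ZMod 7),
          (∀ ℓ ∈ (55357 : ℕ).primeFactors, Function.Surjective (ψ ℓ)) ∧ kuriharaNumber D.f 7 55357 ψ ≠ 0) :
    haveI := isElliptic_c794a1; haveI := isGloballyMinimal_c794a1;
      haveI : NeZero (((⟨1, 0, 1, -3, 2⟩ : WeierstrassCurve ℤ).map (Int.castRingHom ℚ)).conductorNorm ℤ) := neZero_conductorNorm_of_isElliptic _;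
      haveI := Fact.mk (by norm_num : Nat.Prime 7);
    haveI := minTwist23_isElliptic; haveI := minTwist23_isGloballyMinimal;
    haveI : NeZero (((⟨1, 0, 1, -1334, -30036⟩ : WeierstrassCurve ℤ).map (Int.castRingHom ℚ)).conductorNorm ℤ) := neZero_conductorNorm_of_isElliptic _;
    (∃ (Dt : ModularParametrizationData ((⟨1, 0, 1, -3, 2⟩ : WeierstrassCurve ℤ).map (Int.castRingHom ℚ)) (((⟨1, 0, 1, -3, 2⟩ : WeierstrassCurve ℤ).map (Int.castRingHom ℚ)).conductorNorm ℤ)) (β : ℤ)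
      (ι : K →+* ℂ) (ℓ : ℕ) (d : KolyvaginHeegnerData Dt β ι ℓ),
      ℓ.Prime ∧ Zhang2014.IsKolyvaginPrime (((⟨1, 0, 1, -3, 2⟩ : WeierstrassCurve ℤ).map (Int.castRingHom ℚ)).conductorNorm ℤ) ((⟨1, 0, 1, -3, 2⟩ : WeierstrassCurve ℤ).map (Int.castRingHom ℚ)) K 7 ℓ ∧
        d.kolyvaginClass (p := 7) (by norm_num) 1 ≠ 0) ↔
    (∀ (D : ModularParametrizationData ((⟨1, 0, 1, -1334, -30036⟩ : WeierstrassCurve ℤ).map (Int.castRingHom ℚ))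
          (((⟨1, 0, 1, -1334, -30036⟩ : WeierstrassCurve ℤ).map (Int.castRingHom ℚ)).conductorNorm ℤ)),
        ¬ ((7 : ℕ) : ℤ) ∣ D.maninConstant →
        (∃ u : ℚ, ‖(u : ℚ_[7])‖ = 1 ∧
          ((⟨1, 0, 1, -1334, -30036⟩ : WeierstrassCurve ℤ).map (Int.castRingHom ℚ)).realPeriodRat = u * plusPeriod D.f) →
        ∃ ψ : (q : ℕ) → (ZMod q)ˣ →* Multiplicative (ZMod 7),
          (∀ q ∈ (547 : ℕ).primeFactors, Function.Surjective (ψ q)) ∧ kuriharaNumber D.f 7 547 ψ ≠ 0) := by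
  haveI := isElliptic_c794a1
  haveI := isGloballyMinimal_c794a1
  haveI iNZ : NeZero (((⟨1, 0, 1, -3, 2⟩ : WeierstrassCurve ℤ).map (Int.castRingHom ℚ)).conductorNorm ℤ) :=
    neZero_conductorNorm_of_isElliptic _
  haveI := minTwist23_isElliptic
  haveI := minTwist23_isGloballyMinimal
  haveI iNZT : NeZero (((⟨1, 0, 1, -1334, -30036⟩ : WeierstrassCurve ℤ).map (Int.castRingHom ℚ)).conductorNorm ℤ) :=
    neZero_conductorNorm_of_isElliptic _
  haveI iP := Fact.mk (by norm_num : Nat.Prime 7)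
  haveI : Fact (Nat.Prime 547) := ⟨by norm_num⟩
  haveI : NeZero (547 : ℕ) := ⟨by norm_num⟩
  constructor
  · intro hbit
    exact twistKuriharaClaim_547_of_bit h372 h84 hSak3 K hK hD hbit
  · intro hunit
    refine (kolyvaginPrime_iff_twistKuriharaBit_7_neg23 h372 h84 hKim hSak1 hSak2 hnf hMaz K hK hD hδE).mpr fun D hc hu ↦ ?_
    obtain ⟨ψ, hψ, hne⟩ := hunit D hc hu
    refine ⟨547, inferInstance, minTwist23_isCyclicKolyvaginLevel_7_547, ?_, ψ, hψ, hne⟩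
    rw [Nat.Prime.primeFactors (by norm_num), Finset.card_singleton]

/-- **AGREEMENT TEST for row `794a1` @ `(7, −23)`: unit at `197` ⟺ unit at `547`** (modulo the named facts and the E-side claim):
two decisive residues that DISAGREE contradict the print facts named (or the engine). Per curve; BSD is not proved by it.
[cite: Sakamoto2022pSelmer, Lemma 4.4, Lemma 4.6 (1)] [cite: Kim2022StructureSelmer, Thm. 1.11] -/
theorem unit_197_iff_unit_547
    (h372 : GrossLMS1991.prop37_2_frobeniusCongruence)
    (h84 : Literature.NumberTheory.EllipticCurves.WZhang2014_lemma84_exists_minimal_kolyvaginClass_one_selmerCard)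
    (hKim : Kim2022_card_selmerGroup_le_pow_of_kuriharaNumber_ne_zero)
    (hSak1 : Sakamoto2022_card_selmerGroup_eq_pow_of_isDeltaMinimal)
    (hSak2 : Sakamoto2022_exists_cyclicLevel_kuriharaNumber_ne_zero)
    (hSak3 : Literature.NumberTheory.EllipticCurves.Sakamoto2022_kuriharaNumber_prime_ne_zero_of_localNondivisible)
    (hnf : exists_isNewformOf) (hMaz : mazur_not_dvd_maninConstant_of_odd)
    (K : Type) [Field K] [NumberField K] (hK : IsImaginaryQuadratic K) (hD : NumberField.discr K = -23)
    (hδE : haveI := isElliptic_c794a1; haveI := isGloballyMinimal_c794a1;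
      haveI : NeZero (((⟨1, 0, 1, -3, 2⟩ : WeierstrassCurve ℤ).map (Int.castRingHom ℚ)).conductorNorm ℤ) := neZero_conductorNorm_of_isElliptic _;
      haveI := Fact.mk (by norm_num : Nat.Prime 7);
      ∀ (D : ModularParametrizationData ((⟨1, 0, 1, -3, 2⟩ : WeierstrassCurve ℤ).map (Int.castRingHom ℚ)) (((⟨1, 0, 1, -3, 2⟩ : WeierstrassCurve ℤ).map (Int.castRingHom ℚ)).conductorNorm ℤ)), ¬ ((7 : ℕ) : ℤ) ∣ D.maninConstant →
        (∃ u : ℚ, ‖(u : ℚ_[7])‖ = 1 ∧ ((⟨1, 0, 1, -3, 2⟩ : WeierstrassCurve ℤ).map (Int.castRingHom ℚ)).realPeriodRat = u * plusPeriod D.f) →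
        ∃ ψ : (ℓ : ℕ) → (ZMod ℓ)ˣ →* Multiplicative (ZMod 7),
          (∀ ℓ ∈ (55357 : ℕ).primeFactors, Function.Surjective (ψ ℓ)) ∧ kuriharaNumber D.f 7 55357 ψ ≠ 0) :
    haveI := isElliptic_c794a1; haveI := isGloballyMinimal_c794a1;
      haveI : NeZero (((⟨1, 0, 1, -3, 2⟩ : WeierstrassCurve ℤ).map (Int.castRingHom ℚ)).conductorNorm ℤ) := neZero_conductorNorm_of_isElliptic _;
      haveI := Fact.mk (by norm_num : Nat.Prime 7);
    haveI := minTwist23_isElliptic; haveI := minTwist23_isGloballyMinimal;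
    haveI : NeZero (((⟨1, 0, 1, -1334, -30036⟩ : WeierstrassCurve ℤ).map (Int.castRingHom ℚ)).conductorNorm ℤ) := neZero_conductorNorm_of_isElliptic _;
    (∀ (D : ModularParametrizationData ((⟨1, 0, 1, -1334, -30036⟩ : WeierstrassCurve ℤ).map (Int.castRingHom ℚ))
          (((⟨1, 0, 1, -1334, -30036⟩ : WeierstrassCurve ℤ).map (Int.castRingHom ℚ)).conductorNorm ℤ)),
        ¬ ((7 : ℕ) : ℤ) ∣ D.maninConstant →
        (∃ u : ℚ, ‖(u : ℚ_[7])‖ = 1 ∧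
          ((⟨1, 0, 1, -1334, -30036⟩ : WeierstrassCurve ℤ).map (Int.castRingHom ℚ)).realPeriodRat = u * plusPeriod D.f) →
        ∃ ψ : (q : ℕ) → (ZMod q)ˣ →* Multiplicative (ZMod 7),
          (∀ q ∈ (197 : ℕ).primeFactors, Function.Surjective (ψ q)) ∧ kuriharaNumber D.f 7 197 ψ ≠ 0) ↔
    (∀ (D : ModularParametrizationData ((⟨1, 0, 1, -1334, -30036⟩ : WeierstrassCurve ℤ).map (Int.castRingHom ℚ))
          (((⟨1, 0, 1, -1334, -30036⟩ : WeierstrassCurve ℤ).map (Int.castRingHom ℚ)).conductorNorm ℤ)),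
        ¬ ((7 : ℕ) : ℤ) ∣ D.maninConstant →
        (∃ u : ℚ, ‖(u : ℚ_[7])‖ = 1 ∧
          ((⟨1, 0, 1, -1334, -30036⟩ : WeierstrassCurve ℤ).map (Int.castRingHom ℚ)).realPeriodRat = u * plusPeriod D.f) →
        ∃ ψ : (q : ℕ) → (ZMod q)ˣ →* Multiplicative (ZMod 7),
          (∀ q ∈ (547 : ℕ).primeFactors, Function.Surjective (ψ q)) ∧ kuriharaNumber D.f 7 547 ψ ≠ 0) := by
  haveI := isElliptic_c794a1
  haveI := isGloballyMinimal_c794a1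
  haveI iNZ : NeZero (((⟨1, 0, 1, -3, 2⟩ : WeierstrassCurve ℤ).map (Int.castRingHom ℚ)).conductorNorm ℤ) :=
    neZero_conductorNorm_of_isElliptic _
  haveI := minTwist23_isElliptic
  haveI := minTwist23_isGloballyMinimal
  haveI iNZT : NeZero (((⟨1, 0, 1, -1334, -30036⟩ : WeierstrassCurve ℤ).map (Int.castRingHom ℚ)).conductorNorm ℤ) :=
    neZero_conductorNorm_of_isElliptic _
  haveI iP := Fact.mk (by norm_num : Nat.Prime 7)
  rw [← twistKuriharaBit_iff_unit_197 h372 h84 hKim hSak1 hSak2 hSak3 hnf hMaz K hK hD hδE,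
    twistKuriharaBit_iff_unit_547 h372 h84 hKim hSak1 hSak2 hSak3 hnf hMaz K hK hD hδE]

end C794a1

end Summit.BirchSwinnertonDyer.BirchSwinnertonDyer.Theorems.KolyvaginDepthDoor

end
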